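/-
Copyright (c) 2026 the pub-hodgecm-mathlib formalisation cell (harness21).  Prover seat hodgecm-mathlib-K2E1-p15 (g3), Track B ∕ K2-LIT, h413 = `stmt-HodgeConjecture-24833`,
R90-TF section S8 «ContSpec-n½» (planner R90-CS-plan (g0), hand «p07-early» = S8B#9 made GENERIC and file-independent, dealt 2026-09-04T15:44:36Z): membership in a
ξ-local family travels along a unitary equivalence of discrete automorphic representations.
-/
import Summits.HodgeConjecture.HodgeConjecture.Theorems.R90S8LocalConstituentsInOfEquiv   -- ★ (this seat) the engine `isConstituentOf_finRep_smoothPart_comp_of_equiv`; brings ★ D6 `GlobalAPacketMembership`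
import HarnessLib

/-!
# S8B#9 — `R90S8MemXiFamilyOfEquiv`: `P ≃ᵤ P′ ⇒ (MemXiFamily P … ξ ⇒ MemXiFamily P′ … ξ)` — Rogawski's ξ-local-family membership is an invariant of the unitary
# equivalence class of a discrete automorphic representation

Track B ∕ K2-LIT, crux h413 = `stmt-HodgeConjecture-24833`, route of record `HCCMUnconditional`; cell `hodgecm-mathlib`, R90-TF programme, section S8 «ContSpec-n½»
(§13.9 residual spectrum), support S8B#9 of the S8 socket plan — the GENERIC, file-independent form the planner asked for (signature = R90-CS-plan (g0)
2026-09-04T15:44:36Z verbatim, `H`-generic as ★ D6); file B `R90_S8_ResidualSpectrumU3B` keeps `isPiN_of_equiv` as its B-level statement and reads it through this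
lemma.  THEOREMS ONLY (no `def`, no `instance`, no `notation`, no named-fact hypothesis, no `sorry`; default heartbeats); lane `--supports stmt-HodgeConjecture-24833
--as helper` (count-neutral).

THE MATHEMATICS ([Rogawski1990, §13.3 p. 201, §14.6 p. 246: «the set of `π = ⊗π_v` such that `π_v ∈ Π_v` for all `v`» is a condition on the ISOMORPHISM CLASS of `π`];
[Dixmier1977, §13.1.3]).  ★ `MemXiFamily P hH hHd μω hμu ξ := ∃ Pv, ξ.IsXiLocalFamily … Pv ∧ LocalConstituentsIn P Pv` (D6, `GlobalAPacketMembership`): the finite local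
constituents of `P` lie in SOME ξ-local family of packets.  If `P ≃ᵤ P′` then `P` and `P′` have the same finite local constituents (★ engine
`isConstituentOf_finRep_smoothPart_comp_of_equiv` of `R90S8LocalConstituentsInOfEquiv`, applied to `e⁻¹` at each `inclPlace v`), so the SAME family `Pv` serves `P′`
(★ `MemXiFamily.of_constituents`, the T♭ transfer shape).  No new analysis; two lines over ★.
* §1 **`memXiFamily_of_areUnitarilyEquivalent`** — THE HEAD (S8B#9, generic).
HONEST LABEL: HC_CM is proved only modulo the 7 printed citations (2 remaining named inputs: hLiu418 = `stmt-HodgeConjecture-24832`, h413 = `stmt-HodgeConjecture-24833`) until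
rung 0 closes; this file asserts no named fact and closes no socket; count-neutral.

## References
* [Rogawski1990] J. Rogawski, *Automorphic Representations of Unitary Groups in Three Variables*, Ann. of Math. Stud. 123 (1990), §13.3 p. 201; §14.6 p. 246.
* [Dixmier1977] J. Dixmier, *C\*-algebras* (North-Holland, 1977), §13.1.3.
-/

set_option autoImplicit false
set_option linter.dupNamespace false  -- the mandated namespace `…HodgeConjecture.HodgeConjecture.R90.S8` (LEAD #1 L1) repeats the summit's segment

noncomputable section

open MeasureTheory NumberField IsDedekindDomain
open scoped Matrix ComplexOrder
open Literature.NumberTheory.Automorphic Literature.NumberTheory.Automorphic.UnitaryGroup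
open Literature.NumberTheory.Rogawski1990 Literature.NumberTheory.GaloisRepresentations
open ContRepresentation (AreUnitarilyEquivalent)

namespace Summit.HodgeConjecture.HodgeConjecture.R90.S8

variable {L : Type} [Field L] [NumberField L] [IsCMField L] {H : Matrix (Fin 3) (Fin 3) L}
  {μ μ' : Measure (adelicGroupData (↥(maximalRealSubfield L)) L (IsCMField.complexConj L) 3 H).automorphicQuotient}
  [(adelicGroupData (↥(maximalRealSubfield L)) L (IsCMField.complexConj L) 3 H).IsAutomorphicMeasure μ]
  [(adelicGroupData (↥(maximalRealSubfield L)) L (IsCMField.complexConj L) 3 H).IsAutomorphicMeasure μ']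

/-! ## §1 The head: `MemXiFamily` travels along a unitary equivalence -/

/-- **S8B#9 — membership in a ξ-local family is invariant under unitary equivalence.**  For discrete automorphic representations `P, P′` of `U(H)(𝔸_{L⁺})`
(`H ∈ M₃(L)` hermitian with unit determinant, the D6 frame), Rogawski's fixed unitary Hecke character `μω` and a one-dimensional automorphic `ξ` of `U(2) × U(1)`:
if `P ≃ᵤ P′` (★ `AreUnitarilyEquivalent`) and `P` lies in a ξ-local family (★ `MemXiFamily P hH hHd μω hμu ξ`), then so does `P′` — with the same family, because
unitarily equivalent representations have the same finite local constituents (★ `isConstituentOf_finRep_smoothPart_comp_of_equiv` at `e⁻¹`, fed to ★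
`MemXiFamily.of_constituents`). [cite: Rogawski1990, §13.3 p. 201; §14.6 p. 246] [cite: Dixmier1977, §13.1.3] -/
theorem memXiFamily_of_areUnitarilyEquivalent
    {P : DiscreteAutomorphicRep (adelicGroupData (↥(maximalRealSubfield L)) L (IsCMField.complexConj L) 3 H) μ}
    {P' : DiscreteAutomorphicRep (adelicGroupData (↥(maximalRealSubfield L)) L (IsCMField.complexConj L) 3 H) μ'}
    (h : AreUnitarilyEquivalent P.space.toContRep P'.space.toContRep)
    {hH : (H.map (cmConjRingHom L))ᵀ = H} {hHd : IsUnit H.det} {μω : HeckeCharacter L} {hμu : μω.IsUnitary} {ξ : OneDimAutRepH L}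
    (hP : MemXiFamily P hH hHd μω hμu ξ) : MemXiFamily P' hH hHd μω hμu ξ := by
  obtain ⟨e, -⟩ := h
  exact hP.of_constituents fun v cl hc =>
    isConstituentOf_finRep_smoothPart_comp_of_equiv e.symm (inclPlace (↥(maximalRealSubfield L)) L (IsCMField.complexConj L) 3 H v) hc

end Summit.HodgeConjecture.HodgeConjecture.R90.S8

end
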